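import Summits.BirchSwinnertonDyer.BirchSwinnertonDyer.Theorems.ConjSpanGenAllLevelsDecomposition
import Literature.NumberTheory.Automorphic.CongruenceSubgroupPropertySL2AwayHolds
import HarnessLib

/-!
# The congruence subgroup property applied to `Δ_t(L') = Γ₀(L'; ℤ[1/t])`: a homomorphism on `Δ_t(L')` with finite image
# kills a principal congruence subgroup (MEMO-es §23 BOTTOM, E-es-34 `DeltaHomDiamond` minus the diamond)

Summit `BirchSwinnertonDyer`, cruxes C3 `ManinPrimeToThreeAtNine` (stmt-BirchSwinnertonDyer-22968) / C2 `ManinOddAtFour`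
(stmt-22967), route `ManinLocalTwoThree` (cell bsd-f2-manin); registered stubs `stub_relativeIharaBar331` /
`stub_relativeIharaBarTwo` = the leaf `RelativeIharaShiftVanishingBar p t n` ⟸ (p3 p599806, typer bridge) E-es-35
`ShiftInvariantIsDiamond`, whose bottom (MEMO-es §23) reads: the glued homomorphism `δΦ` of the `A^n`-invariant symbol lives
on a group containing `ι Δ_t(L')` (LEMMA G, landed `…ShiftClosureDelta.lean`), has FINITE image (`Γ₀` finitely generated,
coefficients `p`-torsion) and kills every cusp-fixer; THEN the congruence subgroup property of `SL₂(ℤ[1/t])` — a TREE THEOREM,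
`Literature.NumberTheory.Automorphic.SerreSL2Congruence1970_congruenceSubgroupProperty_away_holds` (cell bsd-f3-mu) — makes it
kill `Γ(M₀ℤ[1/t])`, and `…CongruenceHomParabolic.lean` / `…EisensteinEnd.lean` finish.  This file PROVES the CSP step in
bsd-f3-mu's vocabulary (`Away`, `Delta`):

* `delta_finiteIndex` — `[SL₂(ℤ[1/t]) : Δ_t(L')] < ∞` for a prime `t ∤ L'`, `L' ≥ 1` (reduction `ℤ[1/t] → ℤ/L'` via
  `IsLocalization.Away.lift`; `Δ_t(L')` contains the kernel of `SL₂(ℤ[1/t]) → SL₂(ℤ/L')`, a finite group);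
* `exists_level_kills_of_finite_range` — for any group `G` and any `ψ : Δ_t(L') →* G` with finite range there is `M > 0`
  such that every `g ∈ SL₂(ℤ[1/t])` with `g ≡ 1 (mod M)` entrywise lies in `Δ_t(L')` and has `ψ g = 1`.

Nothing about BSD or Manin's conjecture is proved here.
-/

set_option autoImplicit false
set_option linter.dupNamespace false

open scoped MatrixGroups

open Literature.NumberTheory.Automorphic
  Summit.BirchSwinnertonDyer.BirchSwinnertonDyer.Theorems.ConjSpanGenAllLevels

namespace Summit.BirchSwinnertonDyer.BirchSwinnertonDyer.Theorems.ManinLocalTwoThree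

section DeltaIndex

variable {t L' : ℕ}

/-- **`Δ_t(L')` has finite index in `SL₂(ℤ[1/t])`** (`t` prime, `t ∤ L'`, `L' ≥ 1`): it contains the kernel of the
reduction `SL₂(ℤ[1/t]) → SL₂(ℤ/L')` (defined through `IsLocalization.Away.lift`, `t` being a unit mod `L'`), whose target
is finite. [folklore] -/
theorem delta_finiteIndex (ht : t.Prime) (hL' : ¬ t ∣ L') [NeZero L'] : (Delta t L').FiniteIndex := by
  -- the reduction `φ : ℤ[1/t] → ℤ/L'`
  have hunit : IsUnit ((Int.castRingHom (ZMod L')) (t : ℤ)) := by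
    rw [map_natCast, ZMod.isUnit_iff_coprime]
    exact (Nat.Prime.coprime_iff_not_dvd ht).mpr hL'
  let φ : Away t →+* ZMod L' := IsLocalization.Away.lift (t : ℤ) hunit
  have hφint : ∀ a : ℤ, φ (a : Away t) = (a : ZMod L') := by
    intro a
    have h := IsLocalization.Away.lift_eq (S := Away t) (t : ℤ) hunit a
    rw [eq_intCast, eq_intCast] at h
    exact h
  -- `ker φ ⊆ L'·ℤ[1/t]`
  have hker : ∀ x : Away t, φ x = 0 → ∃ y : Away t, x = (L' : Away t) * y := by
    intro x hx
    obtain ⟨e, a, _, ha, -⟩ := exists_common_denom (p := t) x 0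
    have hta : ((a : ℤ) : ZMod L') = 0 := by
      rw [← hφint, ← ha, map_mul, hx, zero_mul]
    obtain ⟨b, hb⟩ := (ZMod.intCast_zmod_eq_zero_iff_dvd a L').mp hta
    refine ⟨(b : Away t) * (IsLocalization.Away.invSelf (t : ℤ)) ^ e, ?_⟩
    have hinv : ((t : Away t) ^ e) * (IsLocalization.Away.invSelf (t : ℤ)) ^ e = 1 := by
      rw [← mul_pow]
      have : (t : Away t) = algebraMap ℤ (Away t) (t : ℤ) := by rw [map_natCast]
      rw [this, IsLocalization.Away.mul_invSelf, one_pow]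
    calc x = x * (((t : Away t) ^ e) * (IsLocalization.Away.invSelf (t : ℤ)) ^ e) := by rw [hinv, mul_one]
      _ = (a : Away t) * (IsLocalization.Away.invSelf (t : ℤ)) ^ e := by rw [← mul_assoc, ha]
      _ = (L' : Away t) * ((b : Away t) * (IsLocalization.Away.invSelf (t : ℤ)) ^ e) := by
          rw [hb]; push_cast; ring
  -- the reduction on `SL₂` and its kernel
  let red : SL(2, Away t) →* SL(2, ZMod L') := Matrix.SpecialLinearGroup.map φ
  haveI : red.ker.FiniteIndex := Subgroup.finiteIndex_ker red
  apply Subgroup.finiteIndex_of_le (H := red.ker)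
  intro g hg
  have h10 : φ (g 1 0) = 0 := by
    have := congrArg (fun M : SL(2, ZMod L') ↦ (M : Matrix (Fin 2) (Fin 2) (ZMod L')) 1 0) (MonoidHom.mem_ker.mp hg)
    simpa [red] using this
  obtain ⟨y, hy⟩ := hker _ h10
  exact ⟨y, hy⟩

end DeltaIndex

section CSP

variable {t L' : ℕ} {G : Type*} [Group G]

/-- **CSP applied to `Δ_t(L')`**: for `t` prime, `t ∤ L'`, `L' ≥ 1`, every homomorphism `ψ : Δ_t(L') → G` with FINITE range
kills a principal congruence subgroup: there is `M > 0` such that every `g ∈ SL₂(ℤ[1/t])` with `g ≡ 1 (mod M·ℤ[1/t])`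
entrywise lies in `Δ_t(L')` and satisfies `ψ g = 1`.  (`ker ψ` has index `|range ψ| · [SL₂(ℤ[1/t]) : Δ_t(L')] < ∞`, so the
congruence subgroup property of `SL₂(ℤ[1/t])` — tree theorem `SerreSL2Congruence1970_congruenceSubgroupProperty_away_holds`,
consumer `exists_level_forall_dvd_imp_mem` — applies.) [folklore] -/
theorem exists_level_kills_of_finite_range (ht : t.Prime) (hL' : ¬ t ∣ L') [NeZero L']
    (ψ : Delta t L' →* G) [Finite ψ.range] :
    ∃ M : ℕ, 0 < M ∧ ∀ g : SL(2, Away t),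
      (∀ i j, (M : Away t) ∣ (g i j - (1 : SL(2, Away t)) i j)) → ∃ hg : g ∈ Delta t L', ψ ⟨g, hg⟩ = 1 := by
  haveI : (Delta t L').FiniteIndex := delta_finiteIndex ht hL'
  -- `Γ := ker ψ ≤ SL₂(ℤ[1/t])` has finite index
  let Γ : Subgroup SL(2, Away t) := ψ.ker.map (Delta t L').subtype
  have hΓ : Γ.FiniteIndex := by
    refine ⟨?_⟩
    rw [Subgroup.index_map_subtype, Subgroup.index_ker]
    exact mul_ne_zero (Nat.card_pos.ne') (Subgroup.FiniteIndex.index_ne_zero)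
  obtain ⟨M, hM, hmem⟩ := exists_level_forall_dvd_imp_mem SerreSL2Congruence1970_congruenceSubgroupProperty_away_holds
    ht.two_le Γ hΓ
  refine ⟨M, hM, fun g hg ↦ ?_⟩
  obtain ⟨k, hk, hkg⟩ := hmem g hg
  refine ⟨hkg ▸ k.2, ?_⟩
  have : (⟨g, hkg ▸ k.2⟩ : Delta t L') = k := Subtype.ext hkg.symm
  rw [this]
  exact MonoidHom.mem_ker.mp hk

end CSP

end Summit.BirchSwinnertonDyer.BirchSwinnertonDyer.Theorems.ManinLocalTwoThree
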